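import Summits.MatrixMultiplication.MatrixMultiplication.Theorems.SoloBlindTwistGE2

/-!
# The three-point twist: Conjecture E one rank up implies the three-target inequality GE3

Sub-programme (K₃), continuation of `SoloBlindTwist` / `SoloBlindTwistGE2`.  The THREE-POINT TWIST of `h` along
`a₁, a₂` adjoins to the flat copy of `S` in `G × ZMod 3` the points `(0,1), (a₁,1), (a₂,1)` ("`b, b + a₁, b + a₂`");
formally `soloBlindTwist3 h a₁ a₂ = ` the twist along `a₁` with one more apex of value `(a₂, 1)`.
* MASS at `(σ, 1)`: `K((σ,1); S³) = (K(σ; S) + K(σ - a₁; S) + K(σ - a₂; S)) / 2` (`soloBlind_twist3_mass_one`);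
* it is zero-sum free as soon as `S` is and no sub-sum of `S` equals `a₂ + (a₂ - a₁)` (`soloBlind_twist3_zsf`);
* `(σ, 1)` is H-good on it as soon as the three PAIRWISE sums of `σ, σ - a₁, σ - a₂` are not sub-sums of `S`
  (`soloBlind_twist3_hgood_one`).
Consequently (`soloBlind_ge3_of_twist3_conjE`): if Conjecture E holds on the (zero-sum-free) three-point twists of
`S`, then `S` satisfies GE3 — for `y₁, y₂, y₃` with `y₁ + y₂, y₁ + y₃, y₂ + y₃ ∉ Σ⁰(S)` and `y₁ + y₂ + y₃ ∉ Σ⁰(S)`: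
`K(y₁; S) + K(y₂; S) + K(y₃; S) ≤ 1`.  (GE3 is exhaustively true and tight in ranks `≤ 4`; with `SoloBlindTwistGE2`
and the cone lift this exhibits the hierarchy E ⊋ GE2 ⊋ GE3 ⊋ … of multi-target Kraft inequalities as the shadow of
Conjecture E one rank up.)
-/

namespace Summit.MatrixMultiplication.MatrixMultiplication.Theorems

open Finset

universe u v

variable {ι : Type v} [DecidableEq ι]
variable {G : Type u} [AddCommGroup G] [DecidableEq G]

/-- The three-point twist: the twist along `a₁` with a further apex of value `(a₂, 1)`. -/
def soloBlindTwist3 (h : ι → G) (a₁ a₂ : G) : Option (Option (Option ι)) → G × ZMod 3 :=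
  soloBlindAdjoin (soloBlindTwist h a₁) (a₂, 1)

/-- MASS OF THE THREE-POINT TWIST at `(σ, 1)`: half the sum of the three masses one rank down. -/
theorem soloBlind_twist3_mass_one (h : ι → G) (S : Finset ι) (a₁ a₂ σ : G) :
    soloBlindMass (soloBlindTwist3 h a₁ a₂) (insertNone (insertNone (insertNone S))) ((σ, 1) : G × ZMod 3) =
      1 / 2 * (soloBlindMass h S σ + soloBlindMass h S (σ - a₁) + soloBlindMass h S (σ - a₂)) := by
  have e1 : ((1 : ZMod 3) - 1) = 0 := by decide
  rw [soloBlindTwist3, soloBlind_adjoin_mass_any, Prod.mk_sub_mk, e1, soloBlind_twist_mass_one,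
    soloBlind_twist_mass_zero]
  ring

omit [DecidableEq G] in
/-- Full sub-sum formula for the three-point twist. -/
theorem soloBlind_twist3_sum (h : ι → G) (a₁ a₂ : G) (T : Finset (Option (Option (Option ι)))) :
    ∑ o ∈ T, soloBlindTwist3 h a₁ a₂ o =
      (if none ∈ T then ((a₂, 1) : G × ZMod 3) else 0) +
        ((if none ∈ eraseNone T then ((0, 1) : G × ZMod 3) else 0) +
          ((if none ∈ eraseNone (eraseNone T) then ((a₁, 1) : G × ZMod 3) else 0) +
            ((∑ i ∈ eraseNone (eraseNone (eraseNone T)), h i, 0) : G × ZMod 3))) := by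
  rw [soloBlindTwist3, soloBlind_adjoin_sum, soloBlind_twist_sum]

omit [DecidableEq G] in
/-- The three-point twist of a zero-sum-free `h` is zero-sum free when no sub-sum of `S` equals `a₂ + (a₂ - a₁)`. -/
theorem soloBlind_twist3_zsf (three : ∀ g : G, g + g + g = 0) {h : ι → G} {S : Finset ι} (a₁ a₂ : G)
    (zsf : ∀ T ⊆ S, T.Nonempty → ∑ i ∈ T, h i ≠ 0)
    (hfree : ∀ T ⊆ S, ∑ i ∈ T, h i ≠ a₂ + (a₂ - a₁)) :
    ∀ T ⊆ insertNone (insertNone (insertNone S)), T.Nonempty → ∑ o ∈ T, soloBlindTwist3 h a₁ a₂ o ≠ 0 :=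
  soloBlind_adjoin_zsf (soloBlind_cone_three three) (soloBlind_twist_zsf three a₁ zsf)
    (soloBlind_twist_hgood_one h S a₁ a₂ hfree)

omit [DecidableEq G] in
/-- H-GOODNESS of `(σ, 1)` on the three-point twist from the three pairwise conditions. -/
theorem soloBlind_twist3_hgood_one (h : ι → G) (S : Finset ι) (a₁ a₂ σ : G)
    (h12 : ∀ T ⊆ S, ∑ i ∈ T, h i ≠ σ + (σ - a₁))
    (h13 : ∀ T ⊆ S, ∑ i ∈ T, h i ≠ σ + (σ - a₂))
    (h23 : ∀ T ⊆ S, ∑ i ∈ T, h i ≠ (σ - a₁) + (σ - a₂)) :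
    ∀ T ⊆ insertNone (insertNone (insertNone S)),
      ∑ o ∈ T, soloBlindTwist3 h a₁ a₂ o ≠ ((σ, 1) : G × ZMod 3) + (σ, 1) := by
  intro T hT hsum
  rw [soloBlind_twist3_sum, Prod.mk_add_mk] at hsum
  set V := eraseNone (eraseNone (eraseNone T)) with hVdef
  have hV : V ⊆ S := by
    intro i hi
    have hi3 : some (some (some i)) ∈ T := mem_eraseNone.mp (mem_eraseNone.mp (mem_eraseNone.mp hi))
    exact some_mem_insertNone.mp (some_mem_insertNone.mp (some_mem_insertNone.mp (hT hi3)))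
  have h1 := congrArg Prod.fst hsum
  have h2 := congrArg Prod.snd hsum
  by_cases hr : none ∈ T
  · by_cases hp : none ∈ eraseNone T
    · by_cases hq : none ∈ eraseNone (eraseNone T)
      · rw [if_pos hr, if_pos hp, if_pos hq] at h2
        change (1 : ZMod 3) + (1 + (1 + 0)) = 1 + 1 at h2
        exact absurd h2 (by decide)
      · rw [if_pos hr, if_pos hp, if_neg hq] at h1
        change a₂ + (0 + (0 + ∑ i ∈ V, h i)) = σ + σ at h1
        refine h13 V hV (sub_eq_zero.mp ?_)
        have : ∑ i ∈ V, h i - (σ + (σ - a₂)) = a₂ + (0 + (0 + ∑ i ∈ V, h i)) - (σ + σ) := by abel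
        rw [this, h1, sub_self]
    · by_cases hq : none ∈ eraseNone (eraseNone T)
      · rw [if_pos hr, if_neg hp, if_pos hq] at h1
        change a₂ + (0 + (a₁ + ∑ i ∈ V, h i)) = σ + σ at h1
        refine h23 V hV (sub_eq_zero.mp ?_)
        have : ∑ i ∈ V, h i - ((σ - a₁) + (σ - a₂)) = a₂ + (0 + (a₁ + ∑ i ∈ V, h i)) - (σ + σ) := by
          abel
        rw [this, h1, sub_self]
      · rw [if_pos hr, if_neg hp, if_neg hq] at h2
        change (1 : ZMod 3) + (0 + (0 + 0)) = 1 + 1 at h2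
        exact absurd h2 (by decide)
  · by_cases hp : none ∈ eraseNone T
    · by_cases hq : none ∈ eraseNone (eraseNone T)
      · rw [if_neg hr, if_pos hp, if_pos hq] at h1
        change (0 : G) + (0 + (a₁ + ∑ i ∈ V, h i)) = σ + σ at h1
        refine h12 V hV (sub_eq_zero.mp ?_)
        have : ∑ i ∈ V, h i - (σ + (σ - a₁)) = 0 + (0 + (a₁ + ∑ i ∈ V, h i)) - (σ + σ) := by abel
        rw [this, h1, sub_self]
      · rw [if_neg hr, if_pos hp, if_neg hq] at h2
        change (0 : ZMod 3) + (1 + (0 + 0)) = 1 + 1 at h2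
        exact absurd h2 (by decide)
    · by_cases hq : none ∈ eraseNone (eraseNone T)
      · rw [if_neg hr, if_neg hp, if_pos hq] at h2
        change (0 : ZMod 3) + (0 + (1 + 0)) = 1 + 1 at h2
        exact absurd h2 (by decide)
      · rw [if_neg hr, if_neg hp, if_neg hq] at h2
        change (0 : ZMod 3) + (0 + (0 + 0)) = 1 + 1 at h2
        exact absurd h2 (by decide)

/-- GE3 FROM CONJECTURE E ON THE THREE-POINT TWISTS.  If every zero-sum-free three-point twist of `S` satisfies
`K((σ,1)) ≤ 1/2` at its H-good targets `(σ, 1)`, then for all `y₁, y₂, y₃` whose pairwise sums and whose total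
sum are not sub-sums of `S`: `K(y₁; S) + K(y₂; S) + K(y₃; S) ≤ 1`. -/
theorem soloBlind_ge3_of_twist3_conjE (three : ∀ g : G, g + g + g = 0) (h : ι → G) (S : Finset ι)
    (zsf : ∀ T ⊆ S, T.Nonempty → ∑ i ∈ T, h i ≠ 0)
    (hE : ∀ a₁ a₂ σ : G,
      (∀ T ⊆ insertNone (insertNone (insertNone S)), T.Nonempty →
          ∑ o ∈ T, soloBlindTwist3 h a₁ a₂ o ≠ 0) →
      (∀ T ⊆ insertNone (insertNone (insertNone S)),
          ∑ o ∈ T, soloBlindTwist3 h a₁ a₂ o ≠ ((σ, 1) : G × ZMod 3) + (σ, 1)) →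
      soloBlindMass (soloBlindTwist3 h a₁ a₂) (insertNone (insertNone (insertNone S)))
        ((σ, 1) : G × ZMod 3) ≤ 1 / 2)
    (y₁ y₂ y₃ : G)
    (h12 : ∀ T ⊆ S, ∑ i ∈ T, h i ≠ y₁ + y₂) (h13 : ∀ T ⊆ S, ∑ i ∈ T, h i ≠ y₁ + y₃)
    (h23 : ∀ T ⊆ S, ∑ i ∈ T, h i ≠ y₂ + y₃) (h123 : ∀ T ⊆ S, ∑ i ∈ T, h i ≠ y₁ + y₂ + y₃) :
    soloBlindMass h S y₁ + soloBlindMass h S y₂ + soloBlindMass h S y₃ ≤ 1 := by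
  have e2 : y₁ - (y₁ - y₂) = y₂ := sub_sub_cancel y₁ y₂
  have e3 : y₁ - (y₁ - y₃) = y₃ := sub_sub_cancel y₁ y₃
  have eA : (y₁ - y₃) + ((y₁ - y₃) - (y₁ - y₂)) = y₁ + y₂ + y₃ := by
    refine sub_eq_zero.mp ?_
    have : (y₁ - y₃) + ((y₁ - y₃) - (y₁ - y₂)) - (y₁ + y₂ + y₃) = -(y₃ + y₃ + y₃) := by abel
    rw [this, three y₃, neg_zero]
  have hz3 := soloBlind_twist3_zsf three (y₁ - y₂) (y₁ - y₃) zsf (by rw [eA]; exact h123)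
  have hg := soloBlind_twist3_hgood_one h S (y₁ - y₂) (y₁ - y₃) y₁
    (by rw [e2]; exact h12) (by rw [e3]; exact h13) (by rw [e2, e3]; exact h23)
  have := hE (y₁ - y₂) (y₁ - y₃) y₁ hz3 hg
  rw [soloBlind_twist3_mass_one, e2, e3] at this
  linarith

end Summit.MatrixMultiplication.MatrixMultiplication.Theorems
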